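import Mathlib
import Summits.Ventures.PercRepro.TriangleCapStar
import Summits.Ventures.PercRepro.TriangleCapDiagonal

/-!
# PercRepro — the `m = k` diagonal of the cherry table, the extremal graph: a star plus one leaf edge attains
`C(k − 1, 2) + 2`, so the diagonal rows are solved exactly (p3, gen 30)

TriangleCapDiagonal proves `Σ_v C(d(v), 2) ≤ C(k − 1, 2) + 2` for every graph with `m ≤ k` edges on `k`
vertices.  This module exhibits the extremal graph inside the row's class and closes the diagonal rows:

* `starPlus k` — the star `K_{1, k−1}` with centre `0` plus the leaf edge `{1, 2}` on `Fin k`, with its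
  decidable adjacency (`decidableRelStarPlus`) and `starPlus_adj`;
* `k4mFree_starPlus` — it is `K₄⁻`-free: the adjacent ordered pairs inside a `4`-set have the centre as a
  coordinate (at most `2 · 1 · 3`) or lie in the off-diagonal of `S ∩ {1, 2}` (at most `2`);
* the degrees: `deg_starPlus_centre = k − 1`, `deg_starPlus_one = deg_starPlus_two = 2`, `deg_starPlus_far = 1`;
  `cherries_starPlus = C(k − 1, 2) + 2`, `sum_deg_starPlus = 2k`, `card_edges_starPlus = k` (handshake), all
  for `k ≥ 3`;
* **`exists_k4mFree_diagonal`** / **`diagonal_rows_exact`** — for every `k ≥ 3` the `K₄⁻`-free cherry maximum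
  at `(k, k)` is exactly `C(k − 1, 2) + 2`; `diagonal_values` — the table's `8 · 12 · 17 · 23 · 30` at
  `k = 5 … 9`.

With TriangleCapStar / TriangleCapPairwise the table is now exact on every row `m ≤ k`.  Axioms: standard.
-/

namespace PercRepro

namespace TriangleCap

namespace C047

open Finset


/-- The star `K_{1, k−1}` with centre `0` plus the leaf edge `{1, 2}` (a graph on `Fin k` for every `k`). -/
def starPlus (k : ℕ) : SimpleGraph (Fin k) where
  Adj i j := (i.val = 0 ∧ j.val ≠ 0) ∨ (j.val = 0 ∧ i.val ≠ 0) ∨ (i.val = 1 ∧ j.val = 2) ∨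
    (i.val = 2 ∧ j.val = 1)
  symm := ⟨fun i j h => by
    rcases h with ⟨h1, h2⟩ | ⟨h1, h2⟩ | ⟨h1, h2⟩ | ⟨h1, h2⟩
    · exact Or.inr (Or.inl ⟨h1, h2⟩)
    · exact Or.inl ⟨h1, h2⟩
    · exact Or.inr (Or.inr (Or.inr ⟨h2, h1⟩))
    · exact Or.inr (Or.inr (Or.inl ⟨h2, h1⟩))⟩
  loopless := ⟨fun i h => by
    rcases h with ⟨h1, h2⟩ | ⟨h1, h2⟩ | ⟨h1, h2⟩ | ⟨h1, h2⟩ <;> omega⟩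

/-- Adjacency in `starPlus k` is decidable. -/
instance decidableRelStarPlus (k : ℕ) : DecidableRel (starPlus k).Adj :=
  fun i j => inferInstanceAs (Decidable ((i.val = 0 ∧ j.val ≠ 0) ∨ (j.val = 0 ∧ i.val ≠ 0) ∨
    (i.val = 1 ∧ j.val = 2) ∨ (i.val = 2 ∧ j.val = 1)))

/-- `(starPlus k).Adj i j ↔ (i = 0 ∧ j ≠ 0) ∨ (j = 0 ∧ i ≠ 0) ∨ (i = 1 ∧ j = 2) ∨ (i = 2 ∧ j = 1)`. -/
theorem starPlus_adj (k : ℕ) (i j : Fin k) :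
    (starPlus k).Adj i j ↔ (i.val = 0 ∧ j.val ≠ 0) ∨ (j.val = 0 ∧ i.val ≠ 0) ∨
      (i.val = 1 ∧ j.val = 2) ∨ (i.val = 2 ∧ j.val = 1) := Iff.rfl

/-- The adjacent ordered pairs inside `S` have the centre as a coordinate (with the other coordinate off the
centre) or lie in the off-diagonal of `S ∩ {1, 2}`. -/
theorem adjPairs_starPlus_le (k : ℕ) (S : Finset (Fin k)) :
    adjPairs (starPlus k) S ≤
      2 * ((S.filter (fun i : Fin k => i.val = 0)).card * (S.filter (fun i : Fin k => ¬ i.val = 0)).card) +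
        (S.filter (fun i : Fin k => i.val = 1 ∨ i.val = 2)).offDiag.card := by
  unfold adjPairs
  set C := S.filter (fun i : Fin k => i.val = 0) with hC
  set S' := S.filter (fun i : Fin k => ¬ i.val = 0) with hS'
  set P := S.filter (fun i : Fin k => i.val = 1 ∨ i.val = 2) with hP
  have hsub : (S ×ˢ S).filter (fun p => (starPlus k).Adj p.1 p.2) ⊆ C ×ˢ S' ∪ S' ×ˢ C ∪ P.offDiag := by
    intro p hp
    rw [mem_filter, mem_product] at hp
    obtain ⟨⟨h1, h2⟩, hadj⟩ := hp
    rw [starPlus_adj] at hadj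
    rw [mem_union, mem_union, mem_product, mem_product, mem_offDiag, hC, hS', hP, mem_filter,
      mem_filter, mem_filter, mem_filter, mem_filter, mem_filter]
    rcases hadj with ⟨ha, hb⟩ | ⟨ha, hb⟩ | ⟨ha, hb⟩ | ⟨ha, hb⟩
    · exact Or.inl (Or.inl ⟨⟨h1, ha⟩, ⟨h2, hb⟩⟩)
    · exact Or.inl (Or.inr ⟨⟨h1, hb⟩, ⟨h2, ha⟩⟩)
    · exact Or.inr ⟨⟨h1, Or.inl ha⟩, ⟨h2, Or.inr hb⟩, fun h => by rw [h] at ha; omega⟩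
    · exact Or.inr ⟨⟨h1, Or.inr ha⟩, ⟨h2, Or.inl hb⟩, fun h => by rw [h] at ha; omega⟩
  calc ((S ×ˢ S).filter (fun p => (starPlus k).Adj p.1 p.2)).card
      ≤ (C ×ˢ S' ∪ S' ×ˢ C ∪ P.offDiag).card := card_le_card hsub
    _ ≤ (C ×ˢ S' ∪ S' ×ˢ C).card + P.offDiag.card := card_union_le _ _
    _ ≤ (C ×ˢ S').card + (S' ×ˢ C).card + P.offDiag.card := by gcongr; exact card_union_le _ _
    _ = 2 * (C.card * S'.card) + P.offDiag.card := by rw [card_product, card_product]; ring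

/-- **`starPlus k` is `K₄⁻`-free:** a `4`-set with the centre carries `2 · 1 · 3 + 2 = 8` ordered adjacent
pairs at most, one without the centre at most `2`. -/
theorem k4mFree_starPlus (k : ℕ) : K4mFree (starPlus k) := by
  intro S hS
  have h := adjPairs_starPlus_le k S
  have hsum := card_filter_add_card_filter_not (s := S) (fun i : Fin k => i.val = 0)
  rw [hS] at hsum
  have hC : (S.filter (fun i : Fin k => i.val = 0)).card ≤ 1 := card_filter_val_eq_le_one k 0 S
  have hP : (S.filter (fun i : Fin k => i.val = 1 ∨ i.val = 2)).card ≤ 2 := by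
    rw [filter_or]
    exact (card_union_le _ _).trans
      (Nat.add_le_add (card_filter_val_eq_le_one k 1 S) (card_filter_val_eq_le_one k 2 S))
  rw [offDiag_card] at h
  set x := (S.filter (fun i : Fin k => i.val = 0)).card with hx
  set y := (S.filter (fun i : Fin k => ¬ i.val = 0)).card with hy
  set z := (S.filter (fun i : Fin k => i.val = 1 ∨ i.val = 2)).card with hz
  clear_value x y z
  interval_cases x <;> interval_cases z <;> omega

/-- The neighbours of the centre are all the other vertices. -/
theorem filter_adj_starPlus_centre (k : ℕ) (c : Fin k) (hc : c.val = 0) :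
    univ.filter (fun w => (starPlus k).Adj c w) = univ.erase c := by
  ext w
  rw [mem_filter, mem_erase, starPlus_adj]
  constructor
  · rintro ⟨_, (⟨_, h2⟩ | ⟨h1, h2⟩ | ⟨h1, _⟩ | ⟨h1, _⟩)⟩
    · exact ⟨fun h => h2 (by rw [h]; exact hc), mem_univ _⟩
    · omega
    · omega
    · omega
  · rintro ⟨hne, _⟩
    refine ⟨mem_univ _, Or.inl ⟨hc, fun h => hne (Fin.ext (h.trans hc.symm))⟩⟩

/-- The centre has degree `k − 1`. -/
theorem deg_starPlus_centre (k : ℕ) (c : Fin k) (hc : c.val = 0) : deg (starPlus k) c = k - 1 := by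
  unfold deg
  rw [filter_adj_starPlus_centre k c hc, card_erase_of_mem (mem_univ c), card_univ, Fintype.card_fin]

/-- The neighbours of a vertex `v ∉ {0, 1, 2}` lie in `{0}`. -/
theorem filter_adj_starPlus_far_subset (k : ℕ) (v : Fin k) (hv : 3 ≤ v.val) :
    univ.filter (fun w => (starPlus k).Adj v w) ⊆ univ.filter (fun i : Fin k => i.val = 0) := by
  intro w hw
  rw [mem_filter, starPlus_adj] at hw
  rw [mem_filter]
  refine ⟨mem_univ _, ?_⟩
  rcases hw.2 with ⟨h1, _⟩ | ⟨h1, _⟩ | ⟨h1, _⟩ | ⟨h1, _⟩ <;> omega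

/-- A vertex `v ∉ {0, 1, 2}` has degree `≤ 1`. -/
theorem deg_starPlus_far_le_one (k : ℕ) (v : Fin k) (hv : 3 ≤ v.val) : deg (starPlus k) v ≤ 1 :=
  (card_le_card (filter_adj_starPlus_far_subset k v hv)).trans (card_filter_val_eq_le_one k 0 univ)

/-- A vertex `v ∉ {0, 1, 2}` has degree exactly `1` (it sees the centre). -/
theorem deg_starPlus_far (k : ℕ) (v : Fin k) (hv : 3 ≤ v.val) : deg (starPlus k) v = 1 := by
  have hle := deg_starPlus_far_le_one k v hv
  have hpos : 1 ≤ deg (starPlus k) v := by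
    unfold deg
    rw [Nat.one_le_iff_ne_zero, ← pos_iff_ne_zero, card_pos]
    exact ⟨⟨0, by omega⟩, by
      rw [mem_filter, starPlus_adj]
      exact ⟨mem_univ _, Or.inr (Or.inl ⟨rfl, by omega⟩)⟩⟩
  omega

/-- The neighbours of the leaf `1` are the centre `0` and the leaf `2` (`k ≥ 3`). -/
theorem filter_adj_starPlus_one (k : ℕ) (hk : 3 ≤ k) :
    univ.filter (fun w => (starPlus k).Adj ⟨1, by omega⟩ w) =
      {(⟨0, by omega⟩ : Fin k), ⟨2, by omega⟩} := by
  ext w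
  rw [mem_filter, starPlus_adj, mem_insert, mem_singleton, Fin.ext_iff, Fin.ext_iff]
  simp only [mem_univ, true_and]
  omega

/-- The neighbours of the leaf `2` are the centre `0` and the leaf `1` (`k ≥ 3`). -/
theorem filter_adj_starPlus_two (k : ℕ) (hk : 3 ≤ k) :
    univ.filter (fun w => (starPlus k).Adj ⟨2, by omega⟩ w) =
      {(⟨0, by omega⟩ : Fin k), ⟨1, by omega⟩} := by
  ext w
  rw [mem_filter, starPlus_adj, mem_insert, mem_singleton, Fin.ext_iff, Fin.ext_iff]
  simp only [mem_univ, true_and]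
  omega

/-- The leaf `1` has degree `2`. -/
theorem deg_starPlus_one (k : ℕ) (hk : 3 ≤ k) : deg (starPlus k) ⟨1, by omega⟩ = 2 := by
  unfold deg
  rw [filter_adj_starPlus_one k hk, card_pair]
  simp [Fin.ext_iff]

/-- The leaf `2` has degree `2`. -/
theorem deg_starPlus_two (k : ℕ) (hk : 3 ≤ k) : deg (starPlus k) ⟨2, by omega⟩ = 2 := by
  unfold deg
  rw [filter_adj_starPlus_two k hk, card_pair]
  simp [Fin.ext_iff]

/-- A sum over `Fin k` (`k ≥ 3`) of a function `f` is `f 0 + f 1 + f 2 +` the sum over the vertices `≥ 3`. -/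
theorem sum_fin_split_three (k : ℕ) (hk : 3 ≤ k) (f : Fin k → ℕ) :
    ∑ v, f v = f ⟨0, by omega⟩ + f ⟨1, by omega⟩ + f ⟨2, by omega⟩ +
      ∑ v ∈ univ.filter (fun v : Fin k => 3 ≤ v.val), f v := by
  have h01 : (⟨1, by omega⟩ : Fin k) ∈ univ.erase ⟨0, by omega⟩ := by
    rw [mem_erase]; exact ⟨by simp [Fin.ext_iff], mem_univ _⟩
  have h02 : (⟨2, by omega⟩ : Fin k) ∈ (univ.erase ⟨0, by omega⟩).erase ⟨1, by omega⟩ := by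
    rw [mem_erase, mem_erase]
    exact ⟨by simp [Fin.ext_iff], by simp [Fin.ext_iff], mem_univ _⟩
  rw [← add_sum_erase univ f (mem_univ (⟨0, by omega⟩ : Fin k)), ← add_sum_erase _ f h01,
    ← add_sum_erase _ f h02, ← add_assoc, ← add_assoc]
  congr 1
  apply sum_congr
  · ext v
    rw [mem_erase, mem_erase, mem_erase, mem_filter, Ne, Ne, Ne, Fin.ext_iff, Fin.ext_iff, Fin.ext_iff]
    simp only [mem_univ, and_true, true_and]
    omega
  · intro _ _
    rfl

/-- The vertices `≥ 3` of `Fin k` number `k − 3`. -/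
theorem card_filter_three_le (k : ℕ) :
    (univ.filter (fun v : Fin k => 3 ≤ v.val)).card = k - 3 := by
  have hsum := card_filter_add_card_filter_not (s := (univ : Finset (Fin k))) (fun v : Fin k => 3 ≤ v.val)
  have hlt : (univ.filter (fun v : Fin k => ¬ 3 ≤ v.val)).card = min k 3 := by
    rw [← Fin.card_filter_val_lt (n := k) (m := 3)]
    congr 1
    apply filter_congr
    intro v _
    omega
  rw [card_univ, Fintype.card_fin] at hsum
  omega

/-- **`Σ_v C(d(v), 2) = C(k − 1, 2) + 2` on `starPlus k`** (`k ≥ 3`): the centre contributes `C(k − 1, 2)`,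
the two leaves of the extra edge `1` each, every other vertex `0`. -/
theorem cherries_starPlus (k : ℕ) (hk : 3 ≤ k) : cherries (starPlus k) = (k - 1).choose 2 + 2 := by
  unfold cherries
  rw [sum_fin_split_three k hk, deg_starPlus_centre k ⟨0, by omega⟩ rfl, deg_starPlus_one k hk,
    deg_starPlus_two k hk]
  have hrest : ∑ v ∈ univ.filter (fun v : Fin k => 3 ≤ v.val), (deg (starPlus k) v).choose 2 = 0 := by
    apply sum_eq_zero
    intro v hv
    rw [deg_starPlus_far k v (mem_filter.mp hv).2]
    rfl
  rw [hrest]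
  rfl

/-- `Σ_v d(v) = 2k` on `starPlus k` (`k ≥ 3`). -/
theorem sum_deg_starPlus (k : ℕ) (hk : 3 ≤ k) : ∑ v, deg (starPlus k) v = 2 * k := by
  rw [sum_fin_split_three k hk, deg_starPlus_centre k ⟨0, by omega⟩ rfl, deg_starPlus_one k hk,
    deg_starPlus_two k hk]
  have hrest : ∑ v ∈ univ.filter (fun v : Fin k => 3 ≤ v.val), deg (starPlus k) v = k - 3 := by
    rw [← card_filter_three_le k, card_eq_sum_ones]
    apply sum_congr rfl
    intro v hv
    exact deg_starPlus_far k v (mem_filter.mp hv).2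
  rw [hrest]
  omega

/-- `starPlus k` has `k` edges (handshake; `k ≥ 3`). -/
theorem card_edges_starPlus (k : ℕ) (hk : 3 ≤ k) : (starPlus k).edgeFinset.card = k := by
  have h := sum_deg_eq (starPlus k)
  rw [sum_deg_starPlus k hk] at h
  omega

/-- **THE DIAGONAL IS ATTAINED:** for `k ≥ 3` a `K₄⁻`-free graph on `Fin k` with `k` edges and
`Σ_v C(d(v), 2) = C(k − 1, 2) + 2`. -/
theorem exists_k4mFree_diagonal (k : ℕ) (hk : 3 ≤ k) :
    ∃ (D : SimpleGraph (Fin k)) (_ : DecidableRel D.Adj),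
      K4mFree D ∧ D.edgeFinset.card = k ∧ cherries D = (k - 1).choose 2 + 2 :=
  ⟨starPlus k, inferInstance, k4mFree_starPlus k, card_edges_starPlus k hk, cherries_starPlus k hk⟩

/-- **THE DIAGONAL ROWS `m = k` ARE SOLVED EXACTLY** (`k ≥ 3`): every `K₄⁻`-free graph on `Fin k` with `k`
edges has `Σ_v C(d(v), 2) ≤ C(k − 1, 2) + 2` (indeed every graph has), and the star plus one leaf edge
attains it — the table's `(5,5) 8 · (6,6) 12 · (7,7) 17 · (8,8) 23 · (9,9) 30` as one theorem. -/
theorem diagonal_rows_exact (k : ℕ) (hk : 3 ≤ k) :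
    (∀ (D : SimpleGraph (Fin k)) [DecidableRel D.Adj], K4mFree D → D.edgeFinset.card = k →
        cherries D ≤ (k - 1).choose 2 + 2) ∧
      ∃ (D : SimpleGraph (Fin k)) (_ : DecidableRel D.Adj),
        K4mFree D ∧ D.edgeFinset.card = k ∧ cherries D = (k - 1).choose 2 + 2 :=
  ⟨fun D _ _ hD => cherries_le_of_card_edges_eq k D hD, exists_k4mFree_diagonal k hk⟩

/-- The diagonal values of the census table: `8`, `12`, `17`, `23`, `30` at `k = 5 … 9`. -/
theorem diagonal_values :
    cherries (starPlus 5) = 8 ∧ cherries (starPlus 6) = 12 ∧ cherries (starPlus 7) = 17 ∧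
      cherries (starPlus 8) = 23 ∧ cherries (starPlus 9) = 30 := by
  refine ⟨?_, ?_, ?_, ?_, ?_⟩ <;> rw [cherries_starPlus _ (by norm_num)] <;> decide

end C047

end TriangleCap

end PercRepro
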